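import Mathlib
import HarnessLib
import Summits.Ventures.LatticeQCDFlow.Scaling.AcceptanceVolumeFloorPi

/-!
# LatticeQCDFlow / Scaling — the acceptance of a factorised flow DECAYS GEOMETRICALLY in the number
# of blocks on a GENERAL space: `acc(⊗ᵢ pᵢ, ⊗ᵢ qᵢ) ≤ ∏ᵢ BC(pᵢ, qᵢ)²`, `BC < 1` unless `p = q` a.e.

HONEST FRAMING: exact (Metropolis-corrected) sampling algorithms for lattice gauge theory;
figures of merit are autocorrelation/cost numbers at stated couplings and volumes; no
continuum-physics claim.

Venture `LatticeQCDFlow` (cell pub-lqcd), topic `Scaling`; FANOUT row 3 (`s0-u1-a`, S0-B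
implementation A, GEN-12).  NEW WORK of the cell (elementary), companion of
`Scaling/AcceptanceVolumeFloorPi` (imported: the `Measure.pi` density setting, `piDensity_facts`,
the FLOOR `acc₁^m ≤ acc_m`).  Row 31's finite `Scaling/Bhattacharyya` has the ceiling `acc ≤ BC²`
(T2-M) and the tensorisation `BC(⊗) = ∏ BCᵢ` on finite configuration spaces; here both are written
on DENSITIES over an arbitrary measure space, so that the two-sided GEOMETRIC LAW of the acceptance
in the volume holds for the cell's continuous-field samplers:

* `integrable_sqrt_mul` — `√(p q) ∈ L¹` for integrable `p, q ≥ 0` (AM–GM domination);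
* **`meanAccept_le_sq_integral_sqrt`** — `acc(p, q) = ∫∫ min(p(a)q(b), p(b)q(a)) ≤ (∫ √(p q))²`
  on any measure space (the pair minimum is below the geometric mean, which factorises);
* `integral_sqrt_mul_eq_one_sub`, `integral_sqrt_mul_le_one`, **`integral_sqrt_mul_eq_one_iff`**,
  `integral_sqrt_mul_lt_one_iff` — for normalised `p, q`: `∫√(pq) = 1 − ½∫(√p − √q)²`, hence
  `BC ≤ 1` with equality iff `p = q` almost everywhere (the flow is perfect);
* `integral_sqrt_mul_pi` — `∫ √(P Q) d(⊗μ) = ∏ᵢ ∫ √(pᵢ qᵢ) dμᵢ` (BC tensorises on general spaces);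
* **`meanAccept_pi_le_prod_sq_integral_sqrt`** — `acc(⊗pᵢ, ⊗qᵢ) ≤ ∏ᵢ (∫ √(pᵢ qᵢ))²`;
* **`meanAccept_pi_const_mem_Icc`** — identical blocks: `acc₁^m ≤ acc_m ≤ (BC₁²)^m`, and
  **`tendsto_meanAccept_pi_const_zero`** — if the block flow is not perfect (`¬ p =ᵐ q`) the
  acceptance of `m` independent copies tends to `0` geometrically as `m → ∞`.

Reading (value-free): on any configuration space, replicating an imperfect block flow over
independent blocks drives the equilibrium acceptance of the exact sampler to zero geometrically,
at a rate between the block acceptance and the squared block Bhattacharyya affinity.  NOT CLAIMED: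
any acceptance or affinity value of ours; nothing re-scored.
-/

namespace Summit.Ventures.LatticeQCDFlow.Theory2

open MeasureTheory Finset Filter Topology

section OneSpace

variable {X : Type*} [MeasurableSpace X] {μ : Measure X}

/-- `√(p q)` is integrable for integrable nonnegative `p, q` (dominated by `(p + q)/2`). [folklore] -/
theorem integrable_sqrt_mul {p q : X → ℝ} (hp0 : ∀ a, 0 ≤ p a) (hpm : Measurable p)
    (hpi : Integrable p μ) (hq0 : ∀ a, 0 ≤ q a) (hqm : Measurable q) (hqi : Integrable q μ) :
    Integrable (fun a => Real.sqrt (p a * q a)) μ := by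
  refine Integrable.mono' (hpi.add hqi) (hpm.mul hqm).sqrt.aestronglyMeasurable
    (Eventually.of_forall fun a => ?_)
  rw [Real.norm_of_nonneg (Real.sqrt_nonneg _)]
  have h : p a * q a ≤ (p a + q a) ^ 2 := by nlinarith [hp0 a, hq0 a, sq_nonneg (p a - q a)]
  calc Real.sqrt (p a * q a) ≤ Real.sqrt ((p a + q a) ^ 2) := Real.sqrt_le_sqrt h
    _ = p a + q a := Real.sqrt_sq (add_nonneg (hp0 a) (hq0 a))

/-- **THE BHATTACHARYYA CEILING ON A GENERAL SPACE**: for nonnegative measurable integrable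
densities `p, q`, `∫∫ min(p(a)q(b), p(b)q(a)) dμ dμ ≤ (∫ √(p q) dμ)²`, i.e. `acc(p, q) ≤ BC(p, q)²`
(the measure-theoretic form of row 31's `accRate_le_bhatt_sq`). [ours] -/
theorem meanAccept_le_sq_integral_sqrt {p q : X → ℝ} (hp0 : ∀ a, 0 ≤ p a) (hpm : Measurable p)
    (hpi : Integrable p μ) (hq0 : ∀ a, 0 ≤ q a) (hqm : Measurable q) (hqi : Integrable q μ) :
    ∫ a, ∫ b, min (p a * q b) (p b * q a) ∂μ ∂μ ≤ (∫ a, Real.sqrt (p a * q a) ∂μ) ^ 2 := by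
  have hfi := integrable_sqrt_mul hp0 hpm hpi hq0 hqm hqi
  -- the pair minimum is below the geometric mean (the tree's `min_le_sqrt_mul`, inlined)
  have hgm : ∀ {F G : ℝ}, 0 ≤ F → 0 ≤ G → min F G ≤ Real.sqrt (F * G) := by
    intro F G hF hG
    have hm : 0 ≤ min F G := le_min hF hG
    have h2 : min F G ^ 2 ≤ F * G := by
      rw [sq]
      exact mul_le_mul (min_le_left _ _) (min_le_right _ _) hm hF
    calc min F G = Real.sqrt (min F G ^ 2) := (Real.sqrt_sq hm).symm
      _ ≤ Real.sqrt (F * G) := Real.sqrt_le_sqrt h2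
  have hpt : ∀ a b, min (p a * q b) (p b * q a) ≤ Real.sqrt (p a * q a) * Real.sqrt (p b * q b) := by
    intro a b
    calc min (p a * q b) (p b * q a) ≤ Real.sqrt (p a * q b * (p b * q a)) :=
          hgm (mul_nonneg (hp0 a) (hq0 b)) (mul_nonneg (hp0 b) (hq0 a))
      _ = Real.sqrt (p a * q a * (p b * q b)) := by ring_nf
      _ = Real.sqrt (p a * q a) * Real.sqrt (p b * q b) :=
          Real.sqrt_mul (mul_nonneg (hp0 a) (hq0 a)) _
  have inner : ∀ a, ∫ b, min (p a * q b) (p b * q a) ∂μ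
      ≤ Real.sqrt (p a * q a) * ∫ b, Real.sqrt (p b * q b) ∂μ := by
    intro a
    rw [← integral_const_mul]
    exact integral_mono_of_nonneg (Eventually.of_forall fun b =>
      le_min (mul_nonneg (hp0 a) (hq0 b)) (mul_nonneg (hp0 b) (hq0 a))) (hfi.const_mul _)
      (Eventually.of_forall fun b => hpt a b)
  calc ∫ a, ∫ b, min (p a * q b) (p b * q a) ∂μ ∂μ
      ≤ ∫ a, Real.sqrt (p a * q a) * ∫ b, Real.sqrt (p b * q b) ∂μ ∂μ :=
        integral_mono_of_nonneg (Eventually.of_forall fun a => integral_nonneg fun b =>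
          le_min (mul_nonneg (hp0 a) (hq0 b)) (mul_nonneg (hp0 b) (hq0 a))) (hfi.mul_const _)
          (Eventually.of_forall inner)
    _ = (∫ a, Real.sqrt (p a * q a) ∂μ) ^ 2 := by rw [integral_mul_const, sq]

/-- **The affinity and the Hellinger deficit**: for normalised `p, q ≥ 0`,
`∫ √(p q) = 1 − ½ ∫ (√p − √q)²`. [folklore] -/
theorem integral_sqrt_mul_eq_one_sub {p q : X → ℝ} (hp0 : ∀ a, 0 ≤ p a) (hpm : Measurable p)
    (hpi : Integrable p μ) (hp1 : ∫ a, p a ∂μ = 1) (hq0 : ∀ a, 0 ≤ q a) (hqm : Measurable q)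
    (hqi : Integrable q μ) (hq1 : ∫ a, q a ∂μ = 1) :
    ∫ a, Real.sqrt (p a * q a) ∂μ
      = 1 - (∫ a, (Real.sqrt (p a) - Real.sqrt (q a)) ^ 2 ∂μ) / 2 := by
  have hfi := integrable_sqrt_mul hp0 hpm hpi hq0 hqm hqi
  have hpt : ∀ a, (Real.sqrt (p a) - Real.sqrt (q a)) ^ 2
      = p a + q a - 2 * Real.sqrt (p a * q a) := by
    intro a
    rw [sub_sq, Real.sq_sqrt (hp0 a), Real.sq_sqrt (hq0 a), Real.sqrt_mul (hp0 a)]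
    ring
  have hadd : Integrable (fun a => p a + q a) μ := hpi.add hqi
  simp_rw [hpt]
  rw [integral_sub hadd (hfi.const_mul 2), integral_add hpi hqi, integral_const_mul, hp1, hq1]
  ring

/-- **`BC ≤ 1`** for normalised densities. [folklore] -/
theorem integral_sqrt_mul_le_one {p q : X → ℝ} (hp0 : ∀ a, 0 ≤ p a) (hpm : Measurable p)
    (hpi : Integrable p μ) (hp1 : ∫ a, p a ∂μ = 1) (hq0 : ∀ a, 0 ≤ q a) (hqm : Measurable q)
    (hqi : Integrable q μ) (hq1 : ∫ a, q a ∂μ = 1) :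
    ∫ a, Real.sqrt (p a * q a) ∂μ ≤ 1 := by
  rw [integral_sqrt_mul_eq_one_sub hp0 hpm hpi hp1 hq0 hqm hqi hq1]
  linarith [integral_nonneg (μ := μ) (f := fun a => (Real.sqrt (p a) - Real.sqrt (q a)) ^ 2)
    fun a => sq_nonneg (Real.sqrt (p a) - Real.sqrt (q a))]

/-- **`BC = 1` iff the flow is perfect**: for normalised `p, q ≥ 0`, `∫ √(p q) = 1 ↔ p = q` a.e.
[folklore] -/
theorem integral_sqrt_mul_eq_one_iff {p q : X → ℝ} (hp0 : ∀ a, 0 ≤ p a) (hpm : Measurable p)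
    (hpi : Integrable p μ) (hp1 : ∫ a, p a ∂μ = 1) (hq0 : ∀ a, 0 ≤ q a) (hqm : Measurable q)
    (hqi : Integrable q μ) (hq1 : ∫ a, q a ∂μ = 1) :
    ∫ a, Real.sqrt (p a * q a) ∂μ = 1 ↔ p =ᵐ[μ] q := by
  have hfi := integrable_sqrt_mul hp0 hpm hpi hq0 hqm hqi
  have hpt : ∀ a, (Real.sqrt (p a) - Real.sqrt (q a)) ^ 2
      = p a + q a - 2 * Real.sqrt (p a * q a) := by
    intro a
    rw [sub_sq, Real.sq_sqrt (hp0 a), Real.sq_sqrt (hq0 a), Real.sqrt_mul (hp0 a)]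
    ring
  have hHi : Integrable (fun a => (Real.sqrt (p a) - Real.sqrt (q a)) ^ 2) μ := by
    have hadd : Integrable (fun a => p a + q a) μ := hpi.add hqi
    have h : Integrable (fun a => p a + q a - 2 * Real.sqrt (p a * q a)) μ :=
      hadd.sub (hfi.const_mul 2)
    exact h.congr (Eventually.of_forall fun a => (hpt a).symm)
  rw [integral_sqrt_mul_eq_one_sub hp0 hpm hpi hp1 hq0 hqm hqi hq1]
  constructor
  · intro h
    have h0 : ∫ a, (Real.sqrt (p a) - Real.sqrt (q a)) ^ 2 ∂μ = 0 := by linarith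
    rw [integral_eq_zero_iff_of_nonneg (fun a => sq_nonneg _) hHi] at h0
    filter_upwards [h0] with a ha
    have hs : Real.sqrt (p a) = Real.sqrt (q a) := by
      have : (Real.sqrt (p a) - Real.sqrt (q a)) ^ 2 = 0 := ha
      nlinarith [sq_nonneg (Real.sqrt (p a) - Real.sqrt (q a))]
    rwa [Real.sqrt_inj (hp0 a) (hq0 a)] at hs
  · intro h
    have h0 : ∫ a, (Real.sqrt (p a) - Real.sqrt (q a)) ^ 2 ∂μ = 0 := by
      rw [integral_eq_zero_iff_of_nonneg (fun a => sq_nonneg _) hHi]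
      filter_upwards [h] with a ha
      show (Real.sqrt (p a) - Real.sqrt (q a)) ^ 2 = 0
      rw [ha, sub_self, zero_pow two_ne_zero]
    rw [h0]
    ring

/-- **`BC < 1` iff the flow is NOT perfect** (normalised `p, q ≥ 0`). [folklore] -/
theorem integral_sqrt_mul_lt_one_iff {p q : X → ℝ} (hp0 : ∀ a, 0 ≤ p a) (hpm : Measurable p)
    (hpi : Integrable p μ) (hp1 : ∫ a, p a ∂μ = 1) (hq0 : ∀ a, 0 ≤ q a) (hqm : Measurable q)
    (hqi : Integrable q μ) (hq1 : ∫ a, q a ∂μ = 1) :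
    ∫ a, Real.sqrt (p a * q a) ∂μ < 1 ↔ ¬ (p =ᵐ[μ] q) := by
  rw [← integral_sqrt_mul_eq_one_iff hp0 hpm hpi hp1 hq0 hqm hqi hq1,
    (integral_sqrt_mul_le_one hp0 hpm hpi hp1 hq0 hqm hqi hq1).lt_iff_ne]

end OneSpace

/-! ## Blocks: the affinity tensorises, the acceptance decays -/

section Blocks

variable {ι : Type*} [Fintype ι] {X : ι → Type*} [∀ i, MeasurableSpace (X i)]
  {μ : (i : ι) → Measure (X i)} [∀ i, SigmaFinite (μ i)]

/-- **The Bhattacharyya affinity tensorises on general spaces**: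
`∫ √(P Q) d(⊗μ) = ∏ᵢ ∫ √(pᵢ qᵢ) dμᵢ` for nonnegative block densities. [folklore] -/
theorem integral_sqrt_mul_pi {p q : (i : ι) → X i → ℝ} (hp0 : ∀ i a, 0 ≤ p i a)
    (hq0 : ∀ i a, 0 ≤ q i a) :
    ∫ x, Real.sqrt ((∏ i, p i (x i)) * ∏ i, q i (x i)) ∂(Measure.pi μ)
      = ∏ i, ∫ a, Real.sqrt (p i a * q i a) ∂(μ i) := by
  have h : ∀ x : (i : ι) → X i, Real.sqrt ((∏ i, p i (x i)) * ∏ i, q i (x i))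
      = ∏ i, Real.sqrt (p i (x i) * q i (x i)) := by
    intro x
    rw [← prod_mul_distrib, Real.sqrt_prod _ fun i _ => mul_nonneg (hp0 i (x i)) (hq0 i (x i))]
  simp_rw [h]
  exact integral_fintype_prod_eq_prod (μ := μ) fun i a => Real.sqrt (p i a * q i a)

/-- **THE ACCEPTANCE OF A FACTORISED FLOW IS BELOW THE PRODUCT OF THE SQUARED BLOCK AFFINITIES
(general space)**: `acc(⊗pᵢ, ⊗qᵢ) ≤ ∏ᵢ (∫ √(pᵢ qᵢ) dμᵢ)²`. [ours] -/
theorem meanAccept_pi_le_prod_sq_integral_sqrt {p q : (i : ι) → X i → ℝ} (hp0 : ∀ i a, 0 ≤ p i a)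
    (hpm : ∀ i, Measurable (p i)) (hpi : ∀ i, Integrable (p i) (μ i)) (hq0 : ∀ i a, 0 ≤ q i a)
    (hqm : ∀ i, Measurable (q i)) (hqi : ∀ i, Integrable (q i) (μ i)) :
    ∫ x, ∫ x', min ((∏ i, p i (x i)) * ∏ i, q i (x' i)) ((∏ i, p i (x' i)) * ∏ i, q i (x i))
          ∂(Measure.pi μ) ∂(Measure.pi μ)
      ≤ ∏ i, (∫ a, Real.sqrt (p i a * q i a) ∂(μ i)) ^ 2 := by
  obtain ⟨hP0, hPm, hPi, -⟩ := piDensity_facts (μ := μ) hp0 hpm hpi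
  obtain ⟨hQ0, hQm, hQi, -⟩ := piDensity_facts (μ := μ) hq0 hqm hqi
  calc ∫ x, ∫ x', min ((∏ i, p i (x i)) * ∏ i, q i (x' i)) ((∏ i, p i (x' i)) * ∏ i, q i (x i))
          ∂(Measure.pi μ) ∂(Measure.pi μ)
      ≤ (∫ x, Real.sqrt ((∏ i, p i (x i)) * ∏ i, q i (x i)) ∂(Measure.pi μ)) ^ 2 :=
        meanAccept_le_sq_integral_sqrt (μ := Measure.pi μ) hP0 hPm hPi hQ0 hQm hQi
    _ = ∏ i, (∫ a, Real.sqrt (p i a * q i a) ∂(μ i)) ^ 2 := by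
        rw [integral_sqrt_mul_pi hp0 hq0, prod_pow]

end Blocks

/-! ## Identical blocks: the two-sided geometric law and the decay to zero -/

section Const

variable {ι : Type*} [Fintype ι] {Y : Type*} [MeasurableSpace Y] {ν : Measure Y} [SigmaFinite ν]

/-- **THE TWO-SIDED GEOMETRIC LAW (identical blocks, general space)**: for `m = card ι` independent
copies of a block flow with nonnegative measurable integrable densities,
`acc(p, q)^m ≤ acc(p^{⊗m}, q^{⊗m}) ≤ (BC(p, q)²)^m`, `BC(p, q) = ∫ √(p q) dν`. [ours] -/
theorem meanAccept_pi_const_mem_Icc {p q : Y → ℝ} (hp0 : ∀ a, 0 ≤ p a) (hpm : Measurable p)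
    (hpi : Integrable p ν) (hq0 : ∀ a, 0 ≤ q a) (hqm : Measurable q) (hqi : Integrable q ν) :
    ∫ x, ∫ x', min ((∏ i : ι, p (x i)) * ∏ i, q (x' i)) ((∏ i, p (x' i)) * ∏ i, q (x i))
          ∂(Measure.pi fun _ : ι => ν) ∂(Measure.pi fun _ : ι => ν)
      ∈ Set.Icc ((∫ a, ∫ b, min (p a * q b) (p b * q a) ∂ν ∂ν) ^ Fintype.card ι)
          (((∫ a, Real.sqrt (p a * q a) ∂ν) ^ 2) ^ Fintype.card ι) := by
  refine ⟨pow_meanAccept_le_meanAccept_pi_const (ι := ι) hp0 hpm hpi hq0 hqm hqi, ?_⟩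
  have h := meanAccept_pi_le_prod_sq_integral_sqrt (ι := ι) (X := fun _ => Y)
    (μ := fun _ : ι => ν) (p := fun _ => p) (q := fun _ => q) (fun _ => hp0) (fun _ => hpm)
    (fun _ => hpi) (fun _ => hq0) (fun _ => hqm) fun _ => hqi
  rwa [prod_const, card_univ] at h

/-- **DECAY TO ZERO**: if the block flow is not perfect (`¬ p = q` a.e., normalised densities),
the acceptance of `m` independent copies is at most `r^m` for the explicit `r = BC(p,q)² < 1`, so it
tends to `0` as `m → ∞` (stated along `ι = Fin m`). [ours] -/
theorem tendsto_meanAccept_pi_const_zero {p q : Y → ℝ} (hp0 : ∀ a, 0 ≤ p a) (hpm : Measurable p)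
    (hpi : Integrable p ν) (hp1 : ∫ a, p a ∂ν = 1) (hq0 : ∀ a, 0 ≤ q a) (hqm : Measurable q)
    (hqi : Integrable q ν) (hq1 : ∫ a, q a ∂ν = 1) (hne : ¬ (p =ᵐ[ν] q)) :
    (∫ a, Real.sqrt (p a * q a) ∂ν) ^ 2 < 1 ∧
    (∀ m : ℕ, ∫ x, ∫ x', min ((∏ i : Fin m, p (x i)) * ∏ i, q (x' i))
        ((∏ i, p (x' i)) * ∏ i, q (x i)) ∂(Measure.pi fun _ : Fin m => ν)
        ∂(Measure.pi fun _ : Fin m => ν) ≤ ((∫ a, Real.sqrt (p a * q a) ∂ν) ^ 2) ^ m) ∧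
    Tendsto (fun m : ℕ => ∫ x, ∫ x', min ((∏ i : Fin m, p (x i)) * ∏ i, q (x' i))
        ((∏ i, p (x' i)) * ∏ i, q (x i)) ∂(Measure.pi fun _ : Fin m => ν)
        ∂(Measure.pi fun _ : Fin m => ν)) atTop (𝓝 0) := by
  have hB0 : 0 ≤ ∫ a, Real.sqrt (p a * q a) ∂ν := integral_nonneg fun a => Real.sqrt_nonneg _
  have hB1 : ∫ a, Real.sqrt (p a * q a) ∂ν < 1 :=
    (integral_sqrt_mul_lt_one_iff hp0 hpm hpi hp1 hq0 hqm hqi hq1).2 hne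
  have hr1 : (∫ a, Real.sqrt (p a * q a) ∂ν) ^ 2 < 1 := by nlinarith
  have hr0 : 0 ≤ (∫ a, Real.sqrt (p a * q a) ∂ν) ^ 2 := sq_nonneg _
  have hup : ∀ m : ℕ, ∫ x, ∫ x', min ((∏ i : Fin m, p (x i)) * ∏ i, q (x' i))
      ((∏ i, p (x' i)) * ∏ i, q (x i)) ∂(Measure.pi fun _ : Fin m => ν)
      ∂(Measure.pi fun _ : Fin m => ν) ≤ ((∫ a, Real.sqrt (p a * q a) ∂ν) ^ 2) ^ m := by
    intro m
    have h := (meanAccept_pi_const_mem_Icc (ι := Fin m) hp0 hpm hpi hq0 hqm hqi).2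
    rwa [Fintype.card_fin] at h
  have hlow : ∀ m : ℕ, 0 ≤ ∫ x, ∫ x', min ((∏ i : Fin m, p (x i)) * ∏ i, q (x' i))
      ((∏ i, p (x' i)) * ∏ i, q (x i)) ∂(Measure.pi fun _ : Fin m => ν)
      ∂(Measure.pi fun _ : Fin m => ν) := fun m =>
    integral_nonneg fun x => integral_nonneg fun x' =>
      le_min (mul_nonneg (prod_nonneg fun i _ => hp0 _) (prod_nonneg fun i _ => hq0 _))
        (mul_nonneg (prod_nonneg fun i _ => hp0 _) (prod_nonneg fun i _ => hq0 _))
  refine ⟨hr1, hup, ?_⟩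
  exact tendsto_of_tendsto_of_tendsto_of_le_of_le tendsto_const_nhds
    (tendsto_pow_atTop_nhds_zero_of_lt_one hr0 hr1) hlow hup

end Const

end Summit.Ventures.LatticeQCDFlow.Theory2
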